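import Summits.Langlands.Langlands.Theorems.WeightMultiplicitySplitWallWindow

set_option linter.dupNamespace false

/-!
# WeightMultiplicitySplitWallWindow — PART B (kernel + the lens-2 forest of record) of the tree twin of the decomp-langlands lens-2-g16 node
`WallWindowSplit` (stmt-Langlands-27007).  §7 and §8 of the kit twin VERBATIM, in the same namespace as PART A (which carries §§1–6: vocabulary,
weight certificates, clauses, the target identity, the three cells KT / EXT / RES + FRAME and their `Iff.rfl` identities).  KERNEL (all mod NOTHING):
R ⟺ KT ∧ EXT ∧ RES (`r_iff_cells`, excluded middle on the two inlined dials); each cell ⟸ R ⟸ Langlands; Langlands ⟺ (KT ∧ EXT ∧ RES) ∧ FRAME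
(`langlands_iff_pieces`); `closes : KT → EXT → RES → FRAME → Langlands` (= the child route's deciding theorem, kit `childroute.glue.lean` VERBATIM);
`frame_of_host`; W_Prim ⟺ six cells; Langlands ⟺ the SIXTEEN lens-2 leaves (`langlands_iff_forest`, through the three landed glues and the born route
files, all by name).  Nothing here proves `Langlands` (rung 0).
-/

namespace Summit.Langlands.Langlands.Theorems.WeightMultiplicitySplitWallWindow

open scoped BigOperators Classical Matrix

/-! ## 7. KERNEL: exactness of the split, necessity, the frame, the deciding theorem -/

/-- R ⟹ each cell (every cell is R with an extra hypothesis). -/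
theorem cells_of_r (hP : Summit.Langlands.Langlands.Theses.MinusculeHodgeTypeSplit.NonMinusculeWallAutomorphy) :
    WallKroneckerWindowTransport ∧ WallExteriorSquareWindowTransport ∧ WindowlessWallAutomorphy :=
  ⟨fun F _ _ Rd n hn hcpt hIH ℓ _ ι ρ hirr hgeo hQ => hP F Rd n hn hcpt hIH ℓ ι ρ hirr hgeo hQ.1,
   fun F _ _ Rd n hn hcpt hIH ℓ _ ι ρ hirr hgeo hQ => hP F Rd n hn hcpt hIH ℓ ι ρ hirr hgeo hQ.1,
   fun F _ _ Rd n hn hcpt hIH ℓ _ ι ρ hirr hgeo hQ => hP F Rd n hn hcpt hIH ℓ ι ρ hirr hgeo hQ.1⟩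

/-- the cells ⟹ R: excluded middle on the two inlined dials (= `childroute.glue.lean`'s body). -/
theorem r_of_cells (hK : WallKroneckerWindowTransport) (hE : WallExteriorSquareWindowTransport) (hR : WindowlessWallAutomorphy) :
    Summit.Langlands.Langlands.Theses.MinusculeHodgeTypeSplit.NonMinusculeWallAutomorphy := by
  intro F _ _ Rd n hn hcpt hIH ℓ _ ι ρ hirr hgeo hQ
  refine Classical.byCases (fun hk => hK F Rd n hn hcpt hIH ℓ ι ρ hirr hgeo ⟨hQ, hk⟩) (fun hk => ?_)
  refine Classical.byCases (fun he => hE F Rd n hn hcpt hIH ℓ ι ρ hirr hgeo ⟨hQ, he⟩) (fun he => ?_)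
  exact hR F Rd n hn hcpt hIH ℓ ι ρ hirr hgeo ⟨hQ, hk, he⟩

/-- **EXACTNESS, mod NOTHING**: R ⟺ KT ∧ EXT ∧ RES. -/
theorem r_iff_cells : Summit.Langlands.Langlands.Theses.MinusculeHodgeTypeSplit.NonMinusculeWallAutomorphy ↔
    WallKroneckerWindowTransport ∧ WallExteriorSquareWindowTransport ∧ WindowlessWallAutomorphy :=
  ⟨cells_of_r, fun h => r_of_cells h.1 h.2.1 h.2.2⟩

/-- two generations composed: W_Prim ⟺ MIN2 ∧ MIN3 ∧ MIN4 ∧ KT ∧ EXT ∧ RES (g11's kernel `wallLieIrreducible_iff_cells` from the landed twin + `r_iff_cells`). -/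
theorem wprim_iff_six_cells : Summit.Langlands.Langlands.Theses.WeightMultiplicitySplit.WallLieIrreducibleAutomorphy ↔
    Summit.Langlands.Langlands.Theses.MinusculeHodgeTypeSplit.MinusculeWallRankTwoAutomorphy ∧ Summit.Langlands.Langlands.Theses.MinusculeHodgeTypeSplit.MinusculeWallRankThreeAutomorphy ∧
      Summit.Langlands.Langlands.Theses.MinusculeHodgeTypeSplit.MinusculeWallRankFourAutomorphy ∧
        (WallKroneckerWindowTransport ∧ WallExteriorSquareWindowTransport ∧ WindowlessWallAutomorphy) := by
  rw [← r_iff_cells]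
  exact Summit.Langlands.Langlands.Theorems.WeightMultiplicitySplitMinusculeHodgeType.wallLieIrreducible_iff_cells

/-- **THE FRAME IS THE HOST ROUTE**: MIN2, MIN3, MIN4, `WallLieIrreducibleFrame` (host items BY NAME) ⟹ (R → Langlands), through the host's certified
`Summit.Langlands.Langlands.Theses.MinusculeHodgeTypeSplit.closes`. -/
theorem frame_of_host (h2 : Summit.Langlands.Langlands.Theses.MinusculeHodgeTypeSplit.MinusculeWallRankTwoAutomorphy) (h3 : Summit.Langlands.Langlands.Theses.MinusculeHodgeTypeSplit.MinusculeWallRankThreeAutomorphy)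
    (h4 : Summit.Langlands.Langlands.Theses.MinusculeHodgeTypeSplit.MinusculeWallRankFourAutomorphy) (hW : Summit.Langlands.Langlands.Theses.MinusculeHodgeTypeSplit.WallLieIrreducibleFrame) : NonMinusculeWallFrame :=
  fun hR => Summit.Langlands.Langlands.Theses.MinusculeHodgeTypeSplit.closes h2 h3 h4 hR hW

/-- the frame over the grand-host's LEAVES: `WallLieIrreducibleFrame` replaced by G, W_A, W_Fin, W_Str, D through the landed W-split glue (g11 twin's `frame_of_host`). -/
theorem frame_of_host_leaves (h2 : Summit.Langlands.Langlands.Theses.MinusculeHodgeTypeSplit.MinusculeWallRankTwoAutomorphy) (h3 : Summit.Langlands.Langlands.Theses.MinusculeHodgeTypeSplit.MinusculeWallRankThreeAutomorphy)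
    (h4 : Summit.Langlands.Langlands.Theses.MinusculeHodgeTypeSplit.MinusculeWallRankFourAutomorphy) (hG : Summit.Langlands.Langlands.Theses.WeightMultiplicitySplit.GenericWeightReciprocity)
    (hWA : Summit.Langlands.Langlands.Theses.WeightMultiplicitySplit.WallAutomorphicToGalois) (hWF : Summit.Langlands.Langlands.Theses.WeightMultiplicitySplit.WallArtinTypeAutomorphy) (hWS : Summit.Langlands.Langlands.Theses.WeightMultiplicitySplit.WallStructuredAutomorphy)
    (hD : Summit.Langlands.Langlands.Theses.WeightMultiplicitySplit.DegenerateWeightReciprocity) : NonMinusculeWallFrame :=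
  frame_of_host h2 h3 h4 (Summit.Langlands.Langlands.Theorems.WeightMultiplicitySplitMinusculeHodgeType.frame_of_host hG hWA hWF hWS hD)

/-- the frame is (trivially) implied by the summit. -/
theorem frame_of_langlands (h : _root_.Langlands) : NonMinusculeWallFrame := fun _ => h

/-- NECESSITY: the target is implied by the summit (one line over the tree's `GlobalLanglandsCorrespondenceGLn`) … -/
theorem r_of_langlands (h : _root_.Langlands) : Summit.Langlands.Langlands.Theses.MinusculeHodgeTypeSplit.NonMinusculeWallAutomorphy := by
  intro F _ _ Rd n hn hcpt _ ℓ _ ι ρ hirr hgeo _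
  obtain ⟨_, hB⟩ := (h F).2 Rd n hn hcpt
  exact hB ℓ ι ρ hirr hgeo

/-- … hence so is every cell (no strengthening anywhere). -/
theorem wallKroneckerWindowTransport_of_langlands (h : _root_.Langlands) : WallKroneckerWindowTransport := (cells_of_r (r_of_langlands h)).1
/-- S ⟹ EXT (necessity). -/
theorem wallExteriorSquareWindowTransport_of_langlands (h : _root_.Langlands) : WallExteriorSquareWindowTransport := (cells_of_r (r_of_langlands h)).2.1
/-- S ⟹ RES (necessity). -/
theorem windowlessWallAutomorphy_of_langlands (h : _root_.Langlands) : WindowlessWallAutomorphy := (cells_of_r (r_of_langlands h)).2.2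

/-- **DECIDING THEOREM of the child route** (= `childroute.glue.lean` VERBATIM): the three cells and the frame ⟹ `_root_.Langlands` BY NAME. -/
theorem closes (hK : WallKroneckerWindowTransport) (hE : WallExteriorSquareWindowTransport) (hR : WindowlessWallAutomorphy)
    (hF : NonMinusculeWallFrame) : _root_.Langlands := by
  refine hF ?_
  intro F _ _ Rd n hn hcpt hIH ℓ _ ι ρ hirr hgeo hQ
  refine Classical.byCases (fun hk => hK F Rd n hn hcpt hIH ℓ ι ρ hirr hgeo ⟨hQ, hk⟩) (fun hk => ?_)
  refine Classical.byCases (fun he => hE F Rd n hn hcpt hIH ℓ ι ρ hirr hgeo ⟨hQ, he⟩) (fun he => ?_)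
  exact hR F Rd n hn hcpt hIH ℓ ι ρ hirr hgeo ⟨hQ, hk, he⟩

/-- the deciding theorem with the HOST ITEMS in place of the frame (what the child route decides, spelled over the host route's open items). -/
theorem closes_host_shape (h2 : Summit.Langlands.Langlands.Theses.MinusculeHodgeTypeSplit.MinusculeWallRankTwoAutomorphy) (h3 : Summit.Langlands.Langlands.Theses.MinusculeHodgeTypeSplit.MinusculeWallRankThreeAutomorphy)
    (h4 : Summit.Langlands.Langlands.Theses.MinusculeHodgeTypeSplit.MinusculeWallRankFourAutomorphy) (hW : Summit.Langlands.Langlands.Theses.MinusculeHodgeTypeSplit.WallLieIrreducibleFrame)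
    (hK : WallKroneckerWindowTransport) (hE : WallExteriorSquareWindowTransport) (hR : WindowlessWallAutomorphy) : _root_.Langlands :=
  closes hK hE hR (frame_of_host h2 h3 h4 hW)

/-- **EXACTNESS of the child route, mod NOTHING**: Langlands ⟺ (KT ∧ EXT ∧ RES) ∧ FRAME. -/
theorem langlands_iff_pieces : _root_.Langlands ↔
    (WallKroneckerWindowTransport ∧ WallExteriorSquareWindowTransport ∧ WindowlessWallAutomorphy) ∧ NonMinusculeWallFrame :=
  ⟨fun h => ⟨cells_of_r (r_of_langlands h), frame_of_langlands h⟩, fun h => closes h.1.1 h.1.2.1 h.1.2.2 h.2⟩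

/-- the IH every cell carries is itself implied by the summit (no cell is vacuously true under Langlands by a false antecedent). -/
theorem multTwoReciprocityBelow_of_langlands (h : _root_.Langlands) (n : ℕ) : MultTwoReciprocityBelow n := by
  intro m _ hm0 L _ _ RdL hcptL
  obtain ⟨hA, hB⟩ := (h L).2 RdL m hm0 hcptL
  exact ⟨fun π hπ _ ℓ _ ι => hA π hπ ℓ ι, fun ℓ _ ι ρ hirr hgeo _ => hB ℓ ι ρ hirr hgeo⟩

/-- the frame is also EQUIVALENT to «R → Langlands» spelled through the cells (bookkeeping: FRAME carries no content beyond the host route). -/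
theorem frame_iff_cells_imp : NonMinusculeWallFrame ↔
    (WallKroneckerWindowTransport → WallExteriorSquareWindowTransport → WindowlessWallAutomorphy → _root_.Langlands) :=
  ⟨fun hF hK hE hR => closes hK hE hR hF, fun h hP => by obtain ⟨hK, hE, hR⟩ := cells_of_r hP; exact h hK hE hR⟩

/-! ## 8. THE LENS-2 FOREST OF RECORD (bookkeeping, all by name): the SIXTEEN open leaves of the four lens-2 routes below the grand-host decide Langlands EXACTLY -/

/-- the sixteen leaves ⟹ Langlands: G (grand-host), W_A, W_Fin, W_Str (host W-siblings), MIN2, MIN3, MIN4 (g11), KT, EXT, RES (this node), D_A, D_Fin, D_Str (host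
D-siblings), SPIN, ACC, RES_D (g15, born route file BY NAME) — through the three LANDED glues `…WallWeightReciprocity_of_split_proof` (33607),
`…DegenerateWeightReciprocity_of_split_proof` (33711), the g11 / g15 twins' kernels and the grand-host's `Summit.Langlands.Langlands.Theses.WeightMultiplicitySplit.closes`.  0 sorry. -/
theorem langlands_of_forest (hG : Summit.Langlands.Langlands.Theses.WeightMultiplicitySplit.GenericWeightReciprocity)
    (hWA : Summit.Langlands.Langlands.Theses.WeightMultiplicitySplit.WallAutomorphicToGalois) (hWF : Summit.Langlands.Langlands.Theses.WeightMultiplicitySplit.WallArtinTypeAutomorphy) (hWS : Summit.Langlands.Langlands.Theses.WeightMultiplicitySplit.WallStructuredAutomorphy)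
    (h2 : Summit.Langlands.Langlands.Theses.MinusculeHodgeTypeSplit.MinusculeWallRankTwoAutomorphy) (h3 : Summit.Langlands.Langlands.Theses.MinusculeHodgeTypeSplit.MinusculeWallRankThreeAutomorphy)
    (h4 : Summit.Langlands.Langlands.Theses.MinusculeHodgeTypeSplit.MinusculeWallRankFourAutomorphy)
    (hK : WallKroneckerWindowTransport) (hE : WallExteriorSquareWindowTransport) (hR : WindowlessWallAutomorphy)
    (hDA : Summit.Langlands.Langlands.Theses.WeightMultiplicitySplit.DegenerateAutomorphicToGalois) (hDF : Summit.Langlands.Langlands.Theses.WeightMultiplicitySplit.DegenerateArtinTypeAutomorphy)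
    (hDS : Summit.Langlands.Langlands.Theses.WeightMultiplicitySplit.DegenerateStructuredAutomorphy)
    (hSP : Summit.Langlands.Langlands.Theses.DegenerateWindowSplit.DegenerateSpinorWindowTransport) (hAC : Summit.Langlands.Langlands.Theses.DegenerateWindowSplit.DegenerateExteriorSquareWindowTransport)
    (hRD : Summit.Langlands.Langlands.Theses.DegenerateWindowSplit.WindowlessDegenerateAutomorphy) : _root_.Langlands :=
  have hWP : Summit.Langlands.Langlands.Theses.WeightMultiplicitySplit.WallLieIrreducibleAutomorphy := wprim_iff_six_cells.2 ⟨h2, h3, h4, hK, hE, hR⟩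
  have hW : Summit.Langlands.Langlands.Theses.WeightMultiplicitySplit.WallWeightReciprocity :=
    Summit.Langlands.Langlands.Theorems.WeightMultiplicitySplit_WallWeightReciprocity_of_split_proof hWA hWF hWS hWP
      (Summit.Langlands.Langlands.Theorems.WeightMultiplicitySplitMinusculeHodgeType.genericRankStep_of_generic hG)
  have hDP : Summit.Langlands.Langlands.Theses.WeightMultiplicitySplit.DegenerateLieIrreducibleAutomorphy :=
    Summit.Langlands.Langlands.Theorems.WeightMultiplicitySplitDegenerateWindow.degenerateLieIrreducible_of_cells hSP hAC hRD
  Summit.Langlands.Langlands.Theses.WeightMultiplicitySplit.closes hG hW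
    (Summit.Langlands.Langlands.Theorems.WeightMultiplicitySplit_DegenerateWeightReciprocity_of_split_proof hDA hDF hDS hDP
      (Summit.Langlands.Langlands.Theorems.WeightMultiplicitySplitDegenerateWindow.multiplicityTwoRankStep_of hG hW))

/-- the grand-host's leaves are Langlands-implied (restrictions of the summit's two clauses; one line each over `GlobalLanglandsCorrespondenceGLn`). -/
theorem genericWeightReciprocity_of_langlands (h : _root_.Langlands) : Summit.Langlands.Langlands.Theses.WeightMultiplicitySplit.GenericWeightReciprocity := by
  intro F _ _
  exact ⟨(h F).1, fun Rd n hn hcpt => ⟨fun π hπ _ ℓ _ ι => ((h F).2 Rd n hn hcpt).1 π hπ ℓ ι,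
    fun ℓ _ ι ρ hirr hgeo _ => ((h F).2 Rd n hn hcpt).2 ℓ ι ρ hirr hgeo⟩⟩
/-- S ⟹ the host leaf W_A (by name). -/
theorem wallAutomorphicToGalois_of_langlands (h : _root_.Langlands) : Summit.Langlands.Langlands.Theses.WeightMultiplicitySplit.WallAutomorphicToGalois := by
  intro F _ _
  exact ⟨(h F).1, fun Rd n hn hcpt _ π hπ _ ℓ _ ι => ((h F).2 Rd n hn hcpt).1 π hπ ℓ ι⟩
/-- S ⟹ the host leaf W_Fin (by name). -/
theorem wallArtinTypeAutomorphy_of_langlands (h : _root_.Langlands) : Summit.Langlands.Langlands.Theses.WeightMultiplicitySplit.WallArtinTypeAutomorphy := by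
  intro F _ _ Rd n hn hcpt _ ℓ _ ι ρ hirr hgeo _
  exact ((h F).2 Rd n hn hcpt).2 ℓ ι ρ hirr hgeo
/-- S ⟹ the host leaf W_Str (by name). -/
theorem wallStructuredAutomorphy_of_langlands (h : _root_.Langlands) : Summit.Langlands.Langlands.Theses.WeightMultiplicitySplit.WallStructuredAutomorphy := by
  intro F _ _ Rd n hn hcpt _ ℓ _ ι ρ hirr hgeo _
  exact ((h F).2 Rd n hn hcpt).2 ℓ ι ρ hirr hgeo
/-- S ⟹ the grand-host leaf D_A (by name). -/
theorem degenerateAutomorphicToGalois_of_langlands (h : _root_.Langlands) : Summit.Langlands.Langlands.Theses.WeightMultiplicitySplit.DegenerateAutomorphicToGalois := by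
  intro F _ _
  exact ⟨(h F).1, fun Rd n hn hcpt _ π hπ _ ℓ _ ι => ((h F).2 Rd n hn hcpt).1 π hπ ℓ ι⟩
/-- S ⟹ the grand-host leaf D_Fin (by name). -/
theorem degenerateArtinTypeAutomorphy_of_langlands (h : _root_.Langlands) : Summit.Langlands.Langlands.Theses.WeightMultiplicitySplit.DegenerateArtinTypeAutomorphy := by
  intro F _ _ Rd n hn hcpt _ ℓ _ ι ρ hirr hgeo _
  exact ((h F).2 Rd n hn hcpt).2 ℓ ι ρ hirr hgeo
/-- S ⟹ the grand-host leaf D_Str (by name). -/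
theorem degenerateStructuredAutomorphy_of_langlands (h : _root_.Langlands) : Summit.Langlands.Langlands.Theses.WeightMultiplicitySplit.DegenerateStructuredAutomorphy := by
  intro F _ _ Rd n hn hcpt _ ℓ _ ι ρ hirr hgeo _
  exact ((h F).2 Rd n hn hcpt).2 ℓ ι ρ hirr hgeo

/-- … and conversely every leaf ⟸ Langlands: the forest is an EXACT decomposition of the summit (mod NOTHING). -/
theorem langlands_iff_forest : _root_.Langlands ↔
    (Summit.Langlands.Langlands.Theses.WeightMultiplicitySplit.GenericWeightReciprocity ∧
      (Summit.Langlands.Langlands.Theses.WeightMultiplicitySplit.WallAutomorphicToGalois ∧ Summit.Langlands.Langlands.Theses.WeightMultiplicitySplit.WallArtinTypeAutomorphy ∧ Summit.Langlands.Langlands.Theses.WeightMultiplicitySplit.WallStructuredAutomorphy) ∧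
      (Summit.Langlands.Langlands.Theses.MinusculeHodgeTypeSplit.MinusculeWallRankTwoAutomorphy ∧ Summit.Langlands.Langlands.Theses.MinusculeHodgeTypeSplit.MinusculeWallRankThreeAutomorphy ∧
        Summit.Langlands.Langlands.Theses.MinusculeHodgeTypeSplit.MinusculeWallRankFourAutomorphy) ∧
      (WallKroneckerWindowTransport ∧ WallExteriorSquareWindowTransport ∧ WindowlessWallAutomorphy) ∧
      (Summit.Langlands.Langlands.Theses.WeightMultiplicitySplit.DegenerateAutomorphicToGalois ∧ Summit.Langlands.Langlands.Theses.WeightMultiplicitySplit.DegenerateArtinTypeAutomorphy ∧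
        Summit.Langlands.Langlands.Theses.WeightMultiplicitySplit.DegenerateStructuredAutomorphy) ∧
      (Summit.Langlands.Langlands.Theses.DegenerateWindowSplit.DegenerateSpinorWindowTransport ∧ Summit.Langlands.Langlands.Theses.DegenerateWindowSplit.DegenerateExteriorSquareWindowTransport ∧
        Summit.Langlands.Langlands.Theses.DegenerateWindowSplit.WindowlessDegenerateAutomorphy)) := by
  constructor
  · intro h
    have hM := Summit.Langlands.Langlands.Theorems.WeightMultiplicitySplitMinusculeHodgeType.cells_of_wallLieIrreducible
      (Summit.Langlands.Langlands.Theorems.WeightMultiplicitySplitMinusculeHodgeType.wallLieIrreducible_of_langlands h)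
    have hD := Summit.Langlands.Langlands.Theorems.WeightMultiplicitySplitDegenerateWindow.cells_of_degenerateLieIrreducible
      (Summit.Langlands.Langlands.Theorems.WeightMultiplicitySplitDegenerateWindow.degenerateLieIrreducible_of_langlands h)
    exact ⟨genericWeightReciprocity_of_langlands h,
      ⟨wallAutomorphicToGalois_of_langlands h, wallArtinTypeAutomorphy_of_langlands h, wallStructuredAutomorphy_of_langlands h⟩,
      ⟨hM.1, hM.2.1, hM.2.2.1⟩, cells_of_r (r_of_langlands h),
      ⟨degenerateAutomorphicToGalois_of_langlands h, degenerateArtinTypeAutomorphy_of_langlands h, degenerateStructuredAutomorphy_of_langlands h⟩,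
      ⟨hD.1, hD.2.1, hD.2.2⟩⟩
  · rintro ⟨hG, ⟨hWA, hWF, hWS⟩, ⟨h2, h3, h4⟩, ⟨hK, hE, hR⟩, ⟨hDA, hDF, hDS⟩, ⟨hSP, hAC, hRD⟩⟩
    exact langlands_of_forest hG hWA hWF hWS h2 h3 h4 hK hE hR hDA hDF hDS hSP hAC hRD

end Summit.Langlands.Langlands.Theorems.WeightMultiplicitySplitWallWindow
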